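import Summits.ResolutionOfSingularities.ResolutionOfSingularities.Theorems.RadicialJungCleanModelsSufficeChartsData
import Summits.ResolutionOfSingularities.ResolutionOfSingularities.Theorems.RadicialJungCleanModelsSufficeChartsCaseA
import Summits.ResolutionOfSingularities.ResolutionOfSingularities.Theorems.RadicialJungCleanResolvesRegularTypeStalk

/-!
# Route `RadicialJung`, crux `CleanModelsSuffice`, line `Sketch`: the Kato charts at a point of
# the model — the local rings of `V^L` and the two cases

Helper for the registered stub `stub_charts` of the skeleton of
`Summit.ResolutionOfSingularities.ResolutionOfSingularities.Theses.RadicialJung.CleanModelsSuffice`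
(stmt-ResolutionOfSingularities-15883). For adapted data `D` (file `…ChartsData`), a toroidal
chart `v` and a point `w ∈ U v`, the Kummer chart of `v` read in the local ring `A = 𝒪_{V,w}` is
`kci v w : P_{a'} → integralClosure A L` (the chart `kummerChartIntegral` of `…ChartsKummer` for
the germs `tw_i` at `w` of the charged sections of `v`). This file proves:

* CASE A (`tw_i ∈ 𝔪_w` for some `i`): `integralClosure A L` is local and `kci v w` is log
  regular (`…ChartsCaseA`, fed with JOINTSOP);
* CASE B (no `tw_i ∈ 𝔪_w`): every value of `kci v w` is a unit, and `w` is of regular type;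
* at EVERY point `w` the ring `integralClosure 𝒪_{V,w} L` is local (Case A for `w`'s own chart at
  a toroidal `w`; the regular order `𝒪_{V,w}[T]/(T^p - u₀)` at a regular-type `w`), so that the
  stalks of `V^L` are these integral closures (`…ChartsStalkIso`);
* over a regular-type point the stalks of `V^L` are regular local rings
  (`CleanResolves.isRegularLocalRing_stalk_normalizationIn_of_regularType`).

`L` is an `𝒪_{V,w}`-algebra through `K(V)` (`stalkAlgebra`, a file-local instance).
-/

noncomputable section

set_option linter.dupNamespace false -- mandated namespace of this single-conjunct summit

open CategoryTheory AlgebraicGeometry TopologicalSpace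
open Literature.AlgebraicGeometry.Resolution

namespace Summit.ResolutionOfSingularities.ResolutionOfSingularities.Theorems.RadicialJung.CleanModelsSuffice

/-- `L` as an `𝒪_{V,w}`-algebra through `𝒪_{V,w} → K(V) → L`. [folklore] -/
abbrev stalkAlgebra (V : Scheme.{0}) [IsIntegral V] (L : Type) [Field L] [Algebra V.functionField L]
    (w : V) : Algebra (V.presheaf.stalk w) L :=
  ((algebraMap V.functionField L).comp (algebraMap (V.presheaf.stalk w) V.functionField)).toAlgebra

attribute [local instance] stalkAlgebra

/-- `𝒪_{V,w} → K(V) → L` is a scalar tower (by definition of `stalkAlgebra`). [folklore] -/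
theorem isScalarTower_stalkAlgebra (V : Scheme.{0}) [IsIntegral V] (L : Type) [Field L]
    [Algebra V.functionField L] (w : V) : IsScalarTower (V.presheaf.stalk w) V.functionField L :=
  IsScalarTower.of_algebraMap_eq fun _ => rfl

attribute [local instance] isScalarTower_stalkAlgebra

namespace AdaptedData

variable {p : ℕ} {V : Scheme.{0}} [IsIntegral V] {L : Type} [Field L] [Algebra V.functionField L]
variable (D : AdaptedData p V L)
variable (hNorm : ∀ {O K L : Type} [CommRing O] [IsDomain O] [Field K] [Algebra O K]
  [IsFractionRing O K] [Field L] [Algebra K L] [Algebra O L] [IsScalarTower O K L]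
  (p : ℕ) (_ : p.Prime) [CharP K p] (_ : Module.finrank K L = p) (m : ℕ)
  (t : Fin (m + 1) → O) (_ : ∀ i, t i ≠ 0) (a : Fin (m + 1) → ℕ) (_ : ∀ i, ¬ p ∣ a i)
  (y : L) (_ : y ∉ Set.range (algebraMap K L))
  (_ : y ^ p = algebraMap O L (∏ i, t i ^ a i)),
  ∃ (y' : L) (a' : Fin (m + 1) → ℕ) (c : ℕ), y' ∉ Set.range (algebraMap K L) ∧
    a' 0 = 1 ∧ (∀ i, 1 ≤ a' i ∧ a' i < p) ∧ ¬ p ∣ c ∧ (∀ i, a' i ≡ c * a i [MOD p]) ∧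
    y' ^ p = algebraMap O L (∏ i, t i ^ a' i))
variable (hp : p.Prime) [CharP V.functionField p] (hdeg : Module.finrank V.functionField L = p)

/-! ## The Kummer chart of `v` read in `𝒪_{V,w}` -/

/-- The germs `tw_i` at `w ∈ U v` of the charged sections of the chart `v`. [folklore] -/
def tw (v : V) (hm : 0 < D.m v) (w : V) (hw : w ∈ D.U v) (i : Fin (D.m v - 1 + 1)) :
    V.presheaf.stalk w :=
  V.presheaf.germ (D.U v) w hw (D.sC v hm i)

omit [CharP V.functionField p] in
include hp in
/-- The `tw_i` are nonzero. [folklore] -/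
theorem tw_ne_zero (v : V) (hm : 0 < D.m v) (w : V) (hw : w ∈ D.U v) (i : Fin (D.m v - 1 + 1)) :
    D.tw v hm w hw i ≠ 0 :=
  D.germ_sC_ne_zero v hm hp w hw i

omit [CharP V.functionField p] in
include hp in
/-- The `tw_i` are nonzero in `L`. [folklore] -/
theorem algebraMap_tw_ne_zero (v : V) (hm : 0 < D.m v) (w : V) (hw : w ∈ D.U v)
    (i : Fin (D.m v - 1 + 1)) : algebraMap (V.presheaf.stalk w) L (D.tw v hm w hw i) ≠ 0 := by
  rw [tw, ← D.uC_eq_algebraMap_germ v hm w hw i]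
  exact D.uC_ne_zero v hm hp i

/-- **The Kummer chart of `v` at `w`**: `P_{a'} → integralClosure 𝒪_{V,w} L`,
`c ↦ y'^{c₀} ∏_{i≠0} tw_i^{c_i}`. [folklore] -/
def kci (v : V) (hm : 0 < D.m v) (w : V) (hw : w ∈ D.U v) :
    Multiplicative (kummerMonoid p (D.a' hNorm hp hdeg v hm)) →*
      integralClosure (V.presheaf.stalk w) L :=
  kummerChartIntegral p (D.a' hNorm hp hdeg v hm) (D.y' hNorm hp hdeg v hm) (D.tw v hm w hw) hp.pos
    (D.y'_ne_zero hNorm hp hdeg v hm) (D.algebraMap_tw_ne_zero hp v hm w hw)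
    (D.y'_pow_eq_algebraMap_germ hNorm hp hdeg v hm w hw)

/-- The values of `kci` in `L` are the values of the Kummer chart `kummerChartFun y' uC`.
[folklore] -/
theorem coe_kci (v : V) (hm : 0 < D.m v) (w : V) (hw : w ∈ D.U v)
    (c : Multiplicative (kummerMonoid p (D.a' hNorm hp hdeg v hm))) :
    (D.kci hNorm hp hdeg v hm w hw c : L) =
      kummerChartFun (D.y' hNorm hp hdeg v hm) (D.uC v hm)
        ((Multiplicative.toAdd c : kummerMonoid p (D.a' hNorm hp hdeg v hm)) :
          Fin (D.m v - 1 + 1) → ℤ) := by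
  have hu : (fun i => algebraMap (V.presheaf.stalk w) L (D.tw v hm w hw i)) = D.uC v hm :=
    funext fun i => (D.uC_eq_algebraMap_germ v hm w hw i).symm
  rw [kci, coe_kummerChartIntegral, kummerChart_apply, hu]

/-- The `p`-th power of a value of `kci` is the weight monomial `∏ tw_i^{w_i(c)}`.
[folklore] -/
theorem coe_kci_pow (v : V) (hm : 0 < D.m v) (w : V) (hw : w ∈ D.U v)
    (c : Multiplicative (kummerMonoid p (D.a' hNorm hp hdeg v hm))) :
    (D.kci hNorm hp hdeg v hm w hw c : L) ^ p = algebraMap (V.presheaf.stalk w) L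
      (∏ i, D.tw v hm w hw i ^ (kummerWeight p (D.a' hNorm hp hdeg v hm)
        ((Multiplicative.toAdd c : kummerMonoid p (D.a' hNorm hp hdeg v hm)) :
          Fin (D.m v - 1 + 1) → ℤ) i).toNat) := by
  rw [kci, coe_kummerChartIntegral, kummerChart_apply]
  exact kummerChartFun_pow_eq_algebraMap p _ _ _ (D.algebraMap_tw_ne_zero hp v hm w hw)
    (D.y'_pow_eq_algebraMap_germ hNorm hp hdeg v hm w hw) (Multiplicative.toAdd c).2

/-! ## Case A -/

section CaseA

variable (hVreg : Scheme.IsRegular V)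
variable (hK4 : ∀ (R : Type) [CommRing R] [IsNoetherianRing R] [IsLocalRing R] (n : ℕ)
  (P : AddSubmonoid (Fin n → ℤ)) (φ : Multiplicative P →* R),
  P.FG → P.NSMulSaturated → Submodule.span ℤ (P : Set (Fin n → ℤ)) = ⊤ →
  LogChart.IsLogRegularLocal P φ → IsDomain R ∧ IsIntegrallyClosed R)
variable (hStruct : ∀ {A K L : Type} [CommRing A] [IsRegularLocalRing A] [Field K]
  [Algebra A K] [IsFractionRing A K] [Field L] [Algebra K L] [Algebra A L] [IsScalarTower A K L]
  (p : ℕ) (_ : p.Prime) [CharP K p] (_ : Module.finrank K L = p) (m : ℕ)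
  (t : Fin (m + 1) → A) (_ : ∀ i, t i ≠ 0) (a : Fin (m + 1) → ℕ) (_ : a 0 = 1)
  (_ : ∀ i, 1 ≤ a i ∧ a i < p) (y : L) (_ : y ∉ Set.range (algebraMap K L))
  (_ : y ^ p = algebraMap A L (∏ i, t i ^ a i)) (z : Fin p → L)
  (_ : ∀ j, z j = y ^ (j : ℕ) / algebraMap A L (∏ i, t i ^ ((j : ℕ) * a i / p))),
  Subalgebra.toSubmodule (Algebra.adjoin A (Set.range z)) = Submodule.span A (Set.range z) ∧
  LinearIndependent A z ∧ Module.Finite A (Algebra.adjoin A (Set.range z)) ∧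
  IsLocalRing (Algebra.adjoin A (Set.range z)) ∧
  IsFractionRing (Algebra.adjoin A (Set.range z)) L)
variable (hLogReg : ∀ {A K L : Type} [CommRing A] [IsRegularLocalRing A] [Field K]
  [Algebra A K] [IsFractionRing A K] [Field L] [Algebra K L] [Algebra A L] [IsScalarTower A K L]
  (p : ℕ) (_ : p.Prime) [CharP K p] (_ : Module.finrank K L = p) (m : ℕ)
  (t : Fin (m + 1) → A) (_ : ∀ i, t i ≠ 0) (a : Fin (m + 1) → ℕ) (_ : a 0 = 1)
  (_ : ∀ i, 1 ≤ a i ∧ a i < p) (y : L) (_ : y ∉ Set.range (algebraMap K L))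
  (_ : y ^ p = algebraMap A L (∏ i, t i ^ a i))
  (S : Finset (Fin (m + 1))) (_ : ∀ i, i ∈ S ↔ t i ∈ IsLocalRing.maximalIdeal A)
  (_ : S.Nonempty)
  (_ : IsRegularLocalRing (A ⧸ Ideal.span (t '' (S : Set (Fin (m + 1))))))
  (_ : ringKrullDim (A ⧸ Ideal.span (t '' (S : Set (Fin (m + 1))))) + (S.card : WithBot ℕ∞) =
    ringKrullDim A)
  (P : AddSubmonoid (Fin (m + 1) → ℤ))
  (_ : ∀ c : Fin (m + 1) → ℤ, c ∈ P ↔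
    0 ≤ c 0 ∧ ∀ i : Fin (m + 1), i ≠ 0 → 0 ≤ (a i : ℤ) * c 0 + (p : ℤ) * c i)
  (φ : Multiplicative P →*
    Algebra.adjoin A (Set.range fun j : Fin p =>
      y ^ (j : ℕ) / algebraMap A L (∏ i, t i ^ ((j : ℕ) * a i / p))))
  (_ : ∀ c : P, ((φ (Multiplicative.ofAdd c) : Algebra.adjoin A (Set.range fun j : Fin p =>
      y ^ (j : ℕ) / algebraMap A L (∏ i, t i ^ ((j : ℕ) * a i / p)))) : L) =
    y ^ ((c : Fin (m + 1) → ℤ) 0) *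
      ∏ i ∈ Finset.univ.erase 0, algebraMap A L (t i) ^ ((c : Fin (m + 1) → ℤ) i)),
  LogChart.IsLogRegularLocal P φ)

include hVreg hK4 hStruct hLogReg in
/-- **Case A at a point**: if some charged section of the toroidal chart `v` vanishes at
`w ∈ U v`, then `integralClosure 𝒪_{V,w} L` is local and the Kummer chart of `v` into it is log
regular. [folklore] -/
theorem caseA (v : V) (hm : 0 < D.m v) (w : V) (hw : w ∈ D.U v)
    (hA : ∃ i, D.tw v hm w hw i ∈ IsLocalRing.maximalIdeal (V.presheaf.stalk w)) :
    IsLocalRing (integralClosure (V.presheaf.stalk w) L) ∧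
      LogChart.IsLogRegularLocal (kummerMonoid p (D.a' hNorm hp hdeg v hm))
        (D.kci hNorm hp hdeg v hm w hw) := by
  haveI : IsRegularLocalRing (V.presheaf.stalk w) := hVreg w
  obtain ⟨hy', ha'0, ha', -, -, -⟩ := D.normalized_spec hNorm hp hdeg v hm
  obtain ⟨dw, tW, ι, hspan, hdim, htW, hinj⟩ := D.jointSop v w hw
  exact isLogRegularLocal_kummerChartIntegral hK4 hStruct hLogReg p hp hdeg (D.m v - 1)
    (D.tw v hm w hw) (D.tw_ne_zero hp v hm w hw) (D.algebraMap_tw_ne_zero hp v hm w hw)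
    (D.a' hNorm hp hdeg v hm) ha'0 ha' (D.y' hNorm hp hdeg v hm) hy' (D.y'_ne_zero hNorm hp hdeg v hm)
    (D.y'_pow_eq_algebraMap_germ hNorm hp hdeg v hm w hw) hA
    ⟨dw, tW, ι ∘ D.cidx v hm, hspan, hdim, fun i hi => htW _ hi,
      fun i j hi hj h => D.cidx_injective v hm (hinj _ _ hi hj h)⟩

include D hNorm hp hdeg hVreg hK4 hStruct hLogReg in
/-- **`integralClosure 𝒪_{V,w} L` is a local ring at every point `w`** (Case A for `w`'s own
chart at a toroidal `w`; the regular order `𝒪_{V,w}[T]/(T^p - u₀)` at a regular-type `w`).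
[folklore] -/
theorem isLocalRing_integralClosure (w : V) : IsLocalRing (integralClosure (V.presheaf.stalk w) L) := by
  haveI : IsRegularLocalRing (V.presheaf.stalk w) := hVreg w
  rcases (D.pointwise w).2.2.2.2.2.2 with ⟨hm, -⟩ | ⟨-, u₀, -, hg, hu⟩
  · refine (D.caseA hNorm hp hdeg hVreg hK4 hStruct hLogReg w hm w (D.hU w) ⟨0, ?_⟩).1
    rw [tw, D.germ_sC]
    exact D.tC_mem w hm 0
  · haveI : CharP (V.presheaf.stalk w) p :=
      RingHom.charP (algebraMap (V.presheaf.stalk w) V.functionField) (IsFractionRing.injective _ _) p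
    haveI : CharP L p := charP_of_injective_ringHom (algebraMap V.functionField L).injective p
    haveI : FiniteDimensional V.functionField L :=
      Module.finite_of_finrank_pos (by rw [hdeg]; exact hp.pos)
    have hyp : D.y w ^ p = algebraMap (V.presheaf.stalk w) L u₀ := by
      rw [← (D.pointwise w).2.1, hg, ← IsScalarTower.algebraMap_apply]
    rcases hu with hwound | ⟨x, hx1, hx2⟩
    · haveI := CleanResolves.isRegularLocalRing_integralClosure_of_wound (K := V.functionField) hp
        hdeg u₀ (D.y w) (D.pointwise w).1 hyp hwound
      infer_instance
    · haveI := CleanResolves.isRegularLocalRing_integralClosure_of_transversal (K := V.functionField)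
        hp hdeg u₀ (D.y w) (D.pointwise w).1 hyp x hx1 (fun h => hx2 (Ideal.mem_sup_left h))
      infer_instance

end CaseA

/-! ## Case B -/

/-- **Case B: all chart values are units**: if no charged section of `v` vanishes at `w`, every
value of the Kummer chart of `v` at `w` is a unit of `integralClosure 𝒪_{V,w} L` (its `p`-th
power is a unit of `𝒪_{V,w}`). [folklore] -/
theorem isUnit_kci (v : V) (hm : 0 < D.m v) (w : V) (hw : w ∈ D.U v)
    (hB : ∀ i, D.tw v hm w hw i ∉ IsLocalRing.maximalIdeal (V.presheaf.stalk w))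
    (c : Multiplicative (kummerMonoid p (D.a' hNorm hp hdeg v hm))) :
    IsUnit (D.kci hNorm hp hdeg v hm w hw c) := by
  refine isUnit_of_pow_eq_algebraMap p hp.pos _ _ ?_ (D.coe_kci_pow hNorm hp hdeg v hm w hw c)
  refine Finset.prod_induction _ IsUnit (fun _ _ => IsUnit.mul) isUnit_one fun i _ => ?_
  exact (IsLocalRing.notMem_maximalIdeal.mp (hB i)).pow _

include hp hdeg in
/-- **The stalks of `V^L` over a regular-type point are regular** (the tree theorem
`CleanResolves.isRegularLocalRing_stalk_normalizationIn_of_regularType`). [folklore] -/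
theorem isRegularLocalRing_stalk_of_m_eq_zero (hVreg : Scheme.IsRegular V) (x : normalizationIn V L)
    (hmw : D.m (normalizationInι V L x) = 0) :
    IsRegularLocalRing ((normalizationIn V L).presheaf.stalk x) := by
  haveI : FiniteDimensional V.functionField L :=
    Module.finite_of_finrank_pos (by rw [hdeg]; exact hp.pos)
  rcases (D.pointwise (normalizationInι V L x)).2.2.2.2.2.2 with ⟨hm, -⟩ | ⟨-, u₀, -, hg, hu⟩
  · omega
  · refine CleanResolves.isRegularLocalRing_stalk_normalizationIn_of_regularType hp V L hdeg x
      (hVreg _) (D.y (normalizationInι V L x)) u₀ (D.pointwise (normalizationInι V L x)).1 ?_ ?_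
    · rw [← hg]; exact (D.pointwise (normalizationInι V L x)).2.1
    · rcases hu with hwound | ⟨c, hc1, hc2⟩
      · exact Or.inl hwound
      · exact Or.inr ⟨c, hc1, fun h => hc2 (Ideal.mem_sup_left h)⟩

end AdaptedData

/-- The germs at `w ∈ U v` of the charged sections of a toroidal chart are nonzero
(explicit-binder form, the registered interface of this helper file). [folklore] -/
theorem adaptedData_tw_ne_zero {p : ℕ} {V : Scheme.{0}} [IsIntegral V] {L : Type} [Field L]
    [Algebra V.functionField L] (D : AdaptedData p V L) (hp : p.Prime) (v : V) (hm : 0 < D.m v)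
    (w : V) (hw : w ∈ D.U v) (i : Fin (D.m v - 1 + 1)) : D.tw v hm w hw i ≠ 0 :=
  D.tw_ne_zero hp v hm w hw i

end Summit.ResolutionOfSingularities.ResolutionOfSingularities.Theorems.RadicialJung.CleanModelsSuffice

end
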